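import Summits.Ventures.YMGap.RobustBall.KernelClusteringBall
import Summits.Ventures.YMGap.Thresholds.PlaquetteSusceptibility
import HarnessLib

/-!
# Venture YMGap, track ROBUST-BALL — FINITE-VOLUME CLUSTERING UNIFORM IN THE VOLUME AND THE BOUNDARY FIELD,
# step 3: finite plaquette susceptibility and the extensive energy-variance ceiling, UNIFORMLY in `(Λ, η)`

HONEST FRAMING. WHAT THIS IS: a venture file (cell `pub-ymgap`, track Y2 ROBUST-BALL, seat ds-3, theorems only): the
finite-volume twin of ds-1's `Thresholds/PlaquetteSusceptibility.lean` / `PlaquetteEnergyVariance.lean`. Those bound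
`Σ_q |Cov_μ(W_p, W_q)|` and `Var_μ(Σ_{p∈P} W_p) ≤ χ·#P` for the infinite-volume DLR states `μ`, one `χ` per `μ`. Here the
state is the FINITE-VOLUME GIBBS DISTRIBUTION `γ_Λ(·|η)` — any finite link volume `Λ`, any boundary field `η` — and
ONE `χ` serves ALL `(Λ, η)`:

* GENERIC (`kernel_summable_abs_cov_plaquette`, `kernel_variance_sum_plaquette_le`): for ANY family of probability
  measures `γ Λ η` on the `SU(N)` link configurations of `ℤ^d` whose covariances of Lipschitz cylinders cluster as
  `|cov_{γ Λ η}(F₁, F₂)| ≤ A · #Λ₁ · #Λ₂ · K₁K₂ · e^{−m d(Λ₁,Λ₂)}` with ONE `(A, m > 0)` for all `(Λ, η)` — the shape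
  delivered by `KernelClusteringBall.lean` — there is ONE `χ = χ(d, N, A, m)` with, for every `Λ`, `η`, every plaquette
  `p` and every finite plaquette set `P`: `Σ_q |cov_{γ Λ η}(W_p, W_q)| ≤ χ` (summable over all plaquettes `q` of `ℤ^d`)
  and `Var_{γ Λ η}(Σ_{p∈P} W_p) ≤ χ · #P`, `W_p = (1/N) Re tr U_p` (tree `zdPlaquetteObs`);
* THE WILSON POINT (`su2_wilson_kernel_susceptibility_upTo_oneTwelfth`, `su2_wilson_kernel_energyVariance_upTo_oneTwelfth`):
  `SU(2)` lattice Yang–Mills on `ℤ⁴`, `0 ≤ β_W ≤ 1/12`: the finite-volume specific heat per plaquette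
  `Var_{γ_Λ(·|η)}(Σ_{p∈P} W_p)/#P` is bounded by ONE constant for all volumes, all boundary fields and all plaquette
  sets — no volume-growing energy-fluctuation peak anywhere inside the window, whatever the boundary condition;
* THE BALL through any robust single-link door (`kernel_energyVariance_of_isKRContraction`).
Mechanism: ds-1's (`abs_cov_zdPlaquetteObs_le_of_decay`, rb-p1's `summable_and_tsum_row_le`, Mathlib
`covariance_sum_sum'`), applied to the kernel instead of the DLR state.
WHAT THIS IS NOT: «specific heat» means this variance density only; lattice strong coupling inside the doors; nothing
about the continuum limit, critical behaviour elsewhere or the Clay problem.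

References (mechanism): B. Simon, *The Statistical Mechanics of Lattice Gases* I (1993), §II.12; R. L. Dobrushin,
S. B. Shlosman, J. Stat. Phys. 46 (1987) 983–1014; the tree's `PlaquetteSusceptibility.lean`, `KernelClusteringBall.lean`.
-/

noncomputable section

open MeasureTheory Filter Function ProbabilityTheory Real
open scoped NNReal
open Literature.Probability.LatticeModels
open Literature.Probability.LatticeModels.DobrushinMetric
open Literature.MathematicalPhysics.QuantumLattice
open Literature.MathematicalPhysics.QuantumFieldTheory hiding ZdEdge
open Summit.Ventures.YMGap.PlaquetteSusceptibility (exp_neg_latticeNorm_le_pow)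

namespace Summit.Ventures.YMGap.RobustBall

variable {d N : ℕ}

/-! ### Generic: uniform clustering of the kernels ⇒ uniform susceptibility and energy-variance ceilings -/

/-- **UNIFORM FINITE-VOLUME PLAQUETTE SUSCEPTIBILITY from uniform kernel clustering.** Let `γ Λ η` be probability
measures on the `SU(N)` link configurations of `ℤ^d` (`d ≥ 1`) such that for ONE `A ≥ 0`, `m > 0` and all `Λ`, `η`,
all Lipschitz cylinders: `|cov_{γ Λ η}(F₁, F₂)| ≤ A · #Λ₁ · #Λ₂ · K₁K₂ · e^{−m d(Λ₁,Λ₂)}`. Then there is ONE `χ` such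
that for every `Λ`, `η` and every plaquette `p` of `ℤ^d`, `q ↦ |cov_{γ Λ η}(W_p, W_q)|` is summable over all plaquettes
and `Σ_q |cov_{γ Λ η}(W_p, W_q)| ≤ χ`. [folklore] -/
theorem kernel_summable_abs_cov_plaquette (hd : 1 ≤ d)
    {γ : Finset (ZdEdge d) → LGConfig d (Matrix.specialUnitaryGroup (Fin N) ℂ) →
      Measure (LGConfig d (Matrix.specialUnitaryGroup (Fin N) ℂ))}
    (hγ : ∀ Λ η, IsProbabilityMeasure (γ Λ η)) {A m : ℝ} (hA : 0 ≤ A) (hm : 0 < m)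
    (hclus : ∀ Λ η (F₁ F₂ : LGConfig d (Matrix.specialUnitaryGroup (Fin N) ℂ) → ℝ) (Λ₁ Λ₂ : Finset (ZdEdge d))
      (K₁ K₂ : ℝ≥0), IsLipschitzCylinder (fundamentalRep (Fin N)) F₁ Λ₁ K₁ →
      IsLipschitzCylinder (fundamentalRep (Fin N)) F₂ Λ₂ K₂ →
        |cov[F₁, F₂; γ Λ η]| ≤ A * Λ₁.card * Λ₂.card * ((K₁ : ℝ) * K₂) * exp (-m * setDistEdges Λ₁ Λ₂)) :
    ∃ χ : ℝ, ∀ Λ η (p : ZdPlaquette d),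
      Summable (fun q : ZdPlaquette d => |cov[zdPlaquetteObs (fundamentalRep (Fin N)) p.1 p.2.1.1 p.2.1.2,
        zdPlaquetteObs (fundamentalRep (Fin N)) q.1 q.2.1.1 q.2.1.2; γ Λ η]|) ∧
        ∑' q : ZdPlaquette d, |cov[zdPlaquetteObs (fundamentalRep (Fin N)) p.1 p.2.1.1 p.2.1.2,
        zdPlaquetteObs (fundamentalRep (Fin N)) q.1 q.2.1.1 q.2.1.2; γ Λ η]| ≤ χ := by
  classical
  -- the plaquette–plaquette decay constant of the tree's `abs_cov_zdPlaquetteObs_le_of_decay` with `c₁ = 16 A`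
  set C' : ℝ := max (max (16 * A) 0 * Real.exp (2 * m) *
      (((4 * (N : ℝ≥0) ^ 3 : ℝ≥0) : ℝ) * ((4 * (N : ℝ≥0) ^ 3 : ℝ≥0) : ℝ) + 1)) (4 * Real.exp (2 * m)) with hC'
  have hC'0 : 0 ≤ C' := le_max_of_le_right (by positivity)
  set r : ℝ := exp (-(m / Real.sqrt d / d)) with hr
  have hr0 : 0 ≤ r := (exp_pos _).le
  have hdpos : (0 : ℝ) < d := by exact_mod_cast (show 0 < d by omega)
  have hr1 : r < 1 := by
    rw [hr]
    refine Real.exp_lt_one_iff.2 (neg_neg_of_pos ?_)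
    positivity
  refine ⟨C' * (numOrient d * ((1 + r) / (1 - r)) ^ d), fun Λ η p => ?_⟩
  haveI := hγ Λ η
  -- the clustering hypothesis in the clause shape of the tree (supports of size `≤ 4`)
  have hc₁ : ∀ (F₁ F₂ : LGConfig d (Matrix.specialUnitaryGroup (Fin N) ℂ) → ℝ)
      (Λ₁ Λ₂ : Finset (ZdEdge d)) (K₁ K₂ : ℝ≥0),
      Λ₁.card ≤ 4 → Λ₂.card ≤ 4 → Disjoint Λ₁ Λ₂ →
      IsLipschitzCylinder (fundamentalRep (Fin N)) F₁ Λ₁ K₁ →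
      IsLipschitzCylinder (fundamentalRep (Fin N)) F₂ Λ₂ K₂ →
        |cov[F₁, F₂; γ Λ η]| ≤ 16 * A * Real.exp (-m * setDistEdges Λ₁ Λ₂) *
          ((K₁ : ℝ) * K₂ + Real.sqrt (∫ U, F₁ U ^ 2 ∂(γ Λ η)) * Real.sqrt (∫ U, F₂ U ^ 2 ∂(γ Λ η))) := by
    intro F₁ F₂ Λ₁ Λ₂ K₁ K₂ h₁ h₂ _ hF₁ hF₂
    have h1 : (Λ₁.card : ℝ) ≤ 4 := by exact_mod_cast h₁
    have h2 : (Λ₂.card : ℝ) ≤ 4 := by exact_mod_cast h₂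
    have hK : (0 : ℝ) ≤ (K₁ : ℝ) * K₂ := by positivity
    have hL : (0 : ℝ) ≤ Real.sqrt (∫ U, F₁ U ^ 2 ∂(γ Λ η)) * Real.sqrt (∫ U, F₂ U ^ 2 ∂(γ Λ η)) := by positivity
    have hE : 0 ≤ exp (-m * setDistEdges Λ₁ Λ₂) := (exp_pos _).le
    calc |cov[F₁, F₂; γ Λ η]| ≤ A * Λ₁.card * Λ₂.card * ((K₁ : ℝ) * K₂) * exp (-m * setDistEdges Λ₁ Λ₂) :=
          hclus Λ η F₁ F₂ Λ₁ Λ₂ K₁ K₂ hF₁ hF₂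
      _ ≤ A * 4 * 4 * ((K₁ : ℝ) * K₂ + Real.sqrt (∫ U, F₁ U ^ 2 ∂(γ Λ η)) * Real.sqrt (∫ U, F₂ U ^ 2 ∂(γ Λ η))) *
            exp (-m * setDistEdges Λ₁ Λ₂) := by
          gcongr
          exact le_add_of_nonneg_right hL
      _ = 16 * A * Real.exp (-m * setDistEdges Λ₁ Λ₂) *
          ((K₁ : ℝ) * K₂ + Real.sqrt (∫ U, F₁ U ^ 2 ∂(γ Λ η)) * Real.sqrt (∫ U, F₂ U ^ 2 ∂(γ Λ η))) := by ring
  -- pointwise domination by the geometric lattice weight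
  have hpt : ∀ q : ZdPlaquette d, |cov[zdPlaquetteObs (fundamentalRep (Fin N)) p.1 p.2.1.1 p.2.1.2,
        zdPlaquetteObs (fundamentalRep (Fin N)) q.1 q.2.1.1 q.2.1.2; γ Λ η]| ≤ C' * r ^ l1 (p.1 - q.1) := by
    intro q
    have hdec := abs_cov_zdPlaquetteObs_le_of_decay (N := N) (by omega) hm hc₁ p.1 q.1 p.2.2 q.2.2
    refine hdec.trans (mul_le_mul_of_nonneg_left ?_ hC'0)
    have := exp_neg_latticeNorm_le_pow hd (div_pos hm (Real.sqrt_pos.2 hdpos)).le (p.1 - q.1)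
    simpa only [hr, neg_mul] using this
  have hrow := summable_and_tsum_row_le (d := d) hC'0 hr0 hr1 p
  have hsum : Summable fun q : ZdPlaquette d => |cov[zdPlaquetteObs (fundamentalRep (Fin N)) p.1 p.2.1.1 p.2.1.2,
        zdPlaquetteObs (fundamentalRep (Fin N)) q.1 q.2.1.1 q.2.1.2; γ Λ η]| :=
    Summable.of_nonneg_of_le (fun q => abs_nonneg _) hpt hrow.1
  exact ⟨hsum, (hsum.tsum_le_tsum hpt hrow.1).trans hrow.2⟩

/-- **UNIFORM EXTENSIVE ENERGY-VARIANCE CEILING from uniform kernel clustering.** Under the hypotheses of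
`kernel_summable_abs_cov_plaquette` there is ONE `χ` such that for every finite link volume `Λ`, every boundary field `η`
and every finite set `P` of plaquettes of `ℤ^d`: `Var_{γ Λ η}(Σ_{p∈P} W_p) ≤ χ · #P` (`Var = Σ_p Σ_q Cov ≤ Σ_p Σ'_q |Cov|`).
[folklore] -/
theorem kernel_variance_sum_plaquette_le (hd : 1 ≤ d)
    {γ : Finset (ZdEdge d) → LGConfig d (Matrix.specialUnitaryGroup (Fin N) ℂ) →
      Measure (LGConfig d (Matrix.specialUnitaryGroup (Fin N) ℂ))}
    (hγ : ∀ Λ η, IsProbabilityMeasure (γ Λ η)) {A m : ℝ} (hA : 0 ≤ A) (hm : 0 < m)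
    (hclus : ∀ Λ η (F₁ F₂ : LGConfig d (Matrix.specialUnitaryGroup (Fin N) ℂ) → ℝ) (Λ₁ Λ₂ : Finset (ZdEdge d))
      (K₁ K₂ : ℝ≥0), IsLipschitzCylinder (fundamentalRep (Fin N)) F₁ Λ₁ K₁ →
      IsLipschitzCylinder (fundamentalRep (Fin N)) F₂ Λ₂ K₂ →
        |cov[F₁, F₂; γ Λ η]| ≤ A * Λ₁.card * Λ₂.card * ((K₁ : ℝ) * K₂) * exp (-m * setDistEdges Λ₁ Λ₂)) :
    ∃ χ : ℝ, ∀ Λ η (P : Finset (ZdPlaquette d)),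
      Var[fun U => ∑ p ∈ P, zdPlaquetteObs (fundamentalRep (Fin N)) p.1 p.2.1.1 p.2.1.2 U; γ Λ η] ≤ χ * P.card := by
  classical
  haveI : SecondCountableTopology (Matrix (Fin N) (Fin N) ℂ) :=
    inferInstanceAs (SecondCountableTopology (Fin N → Fin N → ℂ))
  haveI : SecondCountableTopology (Matrix.specialUnitaryGroup (Fin N) ℂ) :=
    Topology.IsEmbedding.subtypeVal.secondCountableTopology
  obtain ⟨χ, hχ⟩ := kernel_summable_abs_cov_plaquette hd hγ hA hm hclus
  refine ⟨χ, fun Λ η P => ?_⟩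
  haveI := hγ Λ η
  set W : ZdPlaquette d → LGConfig d (Matrix.specialUnitaryGroup (Fin N) ℂ) → ℝ :=
    fun p => zdPlaquetteObs (fundamentalRep (Fin N)) p.1 p.2.1.1 p.2.1.2 with hW
  have hWm : ∀ p : ZdPlaquette d, MemLp (W p) 2 (γ Λ η) := fun p =>
    memLp_of_bounded (a := -1) (b := 1)
      (ae_of_all _ fun U => by
        have h1 := abs_zdPlaquetteObs_le fundamentalRep_mem_unitaryGroup p.1 p.2.1.1 p.2.1.2 U
        simp only [Set.mem_Icc]; exact abs_le.1 h1)
      (isLipschitzCylinder_zdPlaquetteObs p.1 p.2.2).measurable.aestronglyMeasurable 2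
  have hvar : Var[fun U => ∑ p ∈ P, W p U; γ Λ η] = ∑ p ∈ P, ∑ q ∈ P, cov[W p, W q; γ Λ η] := by
    have hsum : (fun U => ∑ p ∈ P, W p U) = ∑ p ∈ P, W p := by funext U; simp
    rw [hsum, ← covariance_self (memLp_finsetSum' P fun p _ => hWm p).aestronglyMeasurable.aemeasurable,
      covariance_sum_sum' (fun p _ => hWm p) (fun q _ => hWm q)]
  rw [hvar]
  calc ∑ p ∈ P, ∑ q ∈ P, cov[W p, W q; γ Λ η] ≤ ∑ p ∈ P, ∑ q ∈ P, |cov[W p, W q; γ Λ η]| :=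
        Finset.sum_le_sum fun p _ => Finset.sum_le_sum fun q _ => le_abs_self _
    _ ≤ ∑ p ∈ P, ∑' q : ZdPlaquette d, |cov[W p, W q; γ Λ η]| :=
        Finset.sum_le_sum fun p _ => (hχ Λ η p).1.sum_le_tsum P fun q _ => abs_nonneg _
    _ ≤ ∑ _p ∈ P, χ := Finset.sum_le_sum fun p _ => (hχ Λ η p).2
    _ = χ * P.card := by rw [Finset.sum_const, nsmul_eq_mul, mul_comm]

/-! ### The tier-1 ball through any robust single-link door -/

/-- **UNIFORM ENERGY-VARIANCE CEILING ON THE TIER-1 BALL from ANY robust single-link door**: under the hypotheses of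
`kernel_covariance_decay_of_isKRContraction` (`IsKRContraction` of the perturbed `SU(N)` specification with row sums
`≤ ρ < 1`, range `R`; `d ≥ 1`) there is ONE `χ` with `Var_{γ^W_Λ(·|η)}(Σ_{p∈P} W_p) ≤ χ · #P` and
`Σ_q |cov_{γ^W_Λ(·|η)}(W_p, W_q)| ≤ χ` for EVERY finite link volume `Λ`, EVERY boundary field `η`, every plaquette `p`
and every finite plaquette set `P`. [folklore] -/
theorem kernel_energyVariance_of_isKRContraction (hd : 1 ≤ d) {β ρ R : ℝ}
    {W : Potential (ZdEdge d) (Matrix.specialUnitaryGroup (Fin N) ℂ)} (hW : W.IsAdapted)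
    (hWb : ∀ X, ∃ C, ∀ U, |W X U| ≤ C)
    {supp : Finset (ZdEdge d) → Finset (Finset (ZdEdge d))} (hsupp : W.IsSupportedBy supp)
    {C : ZdEdge d → ZdEdge d → ℝ}
    (hKR : IsKRContraction (perturbedYM (d := d) (fundamentalRep (Fin N)) (N * β) W supp) suFrobDist
      (perturbedNbr supp) C)
    (hrow : ∀ x, ∑ y ∈ perturbedNbr supp x, C x y ≤ ρ) (hρ : ρ < 1)
    (hR : ∀ e, ∀ X ∈ supp {e}, e ∈ X → ∀ y ∈ X, ‖e.1 - y.1‖ ≤ R) :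
    ∃ χ : ℝ, ∀ (Λ : Finset (ZdEdge d)) (η : LGConfig d (Matrix.specialUnitaryGroup (Fin N) ℂ)),
      (∀ p : ZdPlaquette d,
        Summable (fun q : ZdPlaquette d => |cov[zdPlaquetteObs (fundamentalRep (Fin N)) p.1 p.2.1.1 p.2.1.2,
          zdPlaquetteObs (fundamentalRep (Fin N)) q.1 q.2.1.1 q.2.1.2;
          perturbedYM (d := d) (fundamentalRep (Fin N)) (N * β) W supp Λ η]|) ∧
        ∑' q : ZdPlaquette d, |cov[zdPlaquetteObs (fundamentalRep (Fin N)) p.1 p.2.1.1 p.2.1.2,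
          zdPlaquetteObs (fundamentalRep (Fin N)) q.1 q.2.1.1 q.2.1.2;
          perturbedYM (d := d) (fundamentalRep (Fin N)) (N * β) W supp Λ η]| ≤ χ) ∧
      ∀ P : Finset (ZdPlaquette d),
        Var[fun U => ∑ p ∈ P, zdPlaquetteObs (fundamentalRep (Fin N)) p.1 p.2.1.1 p.2.1.2 U;
          perturbedYM (d := d) (fundamentalRep (Fin N)) (N * β) W supp Λ η] ≤ χ * P.card := by
  haveI : SecondCountableTopology (Matrix (Fin N) (Fin N) ℂ) :=
    inferInstanceAs (SecondCountableTopology (Fin N → Fin N → ℂ))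
  haveI : SecondCountableTopology (Matrix.specialUnitaryGroup (Fin N) ℂ) :=
    Topology.IsEmbedding.subtypeVal.secondCountableTopology
  have hγ : IsSpecification (perturbedYM (d := d) (fundamentalRep (Fin N)) (N * β) W supp) :=
    isSpecification_perturbedYM _ (continuous_fundamentalRep (Fin N)) _ hW hWb hsupp
  have hc'0 : 0 < max ρ (1 / 2) := lt_max_of_lt_right (by norm_num)
  have hc'1 : max ρ (1 / 2) < 1 := max_lt hρ (by norm_num)
  have hκ0 : 0 < -Real.log (max ρ (1 / 2)) := neg_pos.2 (Real.log_neg hc'0 hc'1)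
  have hR₀0 : 0 < max 1 R := zero_lt_one.trans_le (le_max_left _ _)
  set A : ℝ := 2 * (2 * Real.sqrt N) ^ 2 * exp (-Real.log (max ρ (1 / 2))) with hA
  have hA0 : 0 ≤ A := by positivity
  have hm : 0 < -Real.log (max ρ (1 / 2)) / max 1 R := div_pos hκ0 hR₀0
  have hclus : ∀ Λ η (F₁ F₂ : LGConfig d (Matrix.specialUnitaryGroup (Fin N) ℂ) → ℝ) (Λ₁ Λ₂ : Finset (ZdEdge d))
      (K₁ K₂ : ℝ≥0), IsLipschitzCylinder (fundamentalRep (Fin N)) F₁ Λ₁ K₁ →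
      IsLipschitzCylinder (fundamentalRep (Fin N)) F₂ Λ₂ K₂ →
        |cov[F₁, F₂; perturbedYM (d := d) (fundamentalRep (Fin N)) (N * β) W supp Λ η]| ≤
          A * Λ₁.card * Λ₂.card * ((K₁ : ℝ) * K₂) *
            exp (-(-Real.log (max ρ (1 / 2)) / max 1 R) * setDistEdges Λ₁ Λ₂) := by
    intro Λ η F₁ F₂ Λ₁ Λ₂ K₁ K₂ hF₁ hF₂
    have h := kernel_covariance_decay_of_isKRContraction hW hWb hsupp hKR hrow hρ hR Λ η hF₁ hF₂
    refine h.trans (le_of_eq ?_)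
    simp only [hA]
    ring
  obtain ⟨χ₁, hχ₁⟩ := kernel_summable_abs_cov_plaquette hd (fun Λ η => hγ.isProbability Λ η) hA0 hm hclus
  obtain ⟨χ₂, hχ₂⟩ := kernel_variance_sum_plaquette_le hd (fun Λ η => hγ.isProbability Λ η) hA0 hm hclus
  refine ⟨max χ₁ χ₂, fun Λ η => ⟨fun p => ⟨(hχ₁ Λ η p).1, (hχ₁ Λ η p).2.trans (le_max_left _ _)⟩, fun P => ?_⟩⟩
  exact (hχ₂ Λ η P).trans (mul_le_mul_of_nonneg_right (le_max_right _ _) (Nat.cast_nonneg _))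

/-! ### The Wilson point -/

/-- **THE WILSON POINT, SUSCEPTIBILITY**: for `0 ≤ β_W ≤ 1/12` there is ONE `χ` such that for EVERY finite link volume
`Λ` of `ℤ⁴`, EVERY boundary field `η` and every plaquette `p`, the `SU(2)` finite-volume Wilson distribution `γ_Λ(·|η)`
(tree coupling `β_W/2`) has `Σ_q |cov_{γ_Λ(·|η)}(W_p, W_q)| ≤ χ` (summable over all plaquettes `q` of `ℤ⁴`). [folklore] -/
theorem su2_wilson_kernel_susceptibility_upTo_oneTwelfth {βW : ℝ} (h0 : 0 ≤ βW) (h : βW ≤ 1 / 12) :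
    ∃ χ : ℝ, ∀ (Λ : Finset (ZdEdge 4)) (η : LGConfig 4 (Matrix.specialUnitaryGroup (Fin 2) ℂ)) (p : ZdPlaquette 4),
      Summable (fun q : ZdPlaquette 4 => |cov[zdPlaquetteObs (fundamentalRep (Fin 2)) p.1 p.2.1.1 p.2.1.2,
        zdPlaquetteObs (fundamentalRep (Fin 2)) q.1 q.2.1.1 q.2.1.2;
        ymSpecification (d := 4) (fundamentalRep (Fin 2)) (βW / 2) Λ η]|) ∧
        ∑' q : ZdPlaquette 4, |cov[zdPlaquetteObs (fundamentalRep (Fin 2)) p.1 p.2.1.1 p.2.1.2,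
        zdPlaquetteObs (fundamentalRep (Fin 2)) q.1 q.2.1.1 q.2.1.2;
        ymSpecification (d := 4) (fundamentalRep (Fin 2)) (βW / 2) Λ η]| ≤ χ :=
  kernel_summable_abs_cov_plaquette (d := 4) (N := 2) (by norm_num)
    (fun Λ η => isProbabilityMeasure_ymSpecification _ (continuous_fundamentalRep (Fin 2)) _ Λ η)
    (A := 32) (m := Real.log 2) (by norm_num) (Real.log_pos (by norm_num))
    (fun Λ η F₁ F₂ Λ₁ Λ₂ K₁ K₂ hF₁ hF₂ => su2_wilson_kernel_clustering_upTo_oneTwelfth h0 h Λ η hF₁ hF₂)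

/-- **THE WILSON POINT, SPECIFIC HEAT**: for `0 ≤ β_W ≤ 1/12` there is ONE `χ` such that for EVERY finite link volume
`Λ` of `ℤ⁴`, EVERY boundary field `η` and every finite set `P` of plaquettes:
`Var_{γ_Λ(·|η)}(Σ_{p∈P} W_p) ≤ χ · #P` — the finite-volume energy fluctuation per plaquette of `SU(2)` lattice Yang–Mills
is bounded uniformly in the volume, the boundary field and the region. [folklore] -/
theorem su2_wilson_kernel_energyVariance_upTo_oneTwelfth {βW : ℝ} (h0 : 0 ≤ βW) (h : βW ≤ 1 / 12) :
    ∃ χ : ℝ, ∀ (Λ : Finset (ZdEdge 4)) (η : LGConfig 4 (Matrix.specialUnitaryGroup (Fin 2) ℂ))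
      (P : Finset (ZdPlaquette 4)),
      Var[fun U => ∑ p ∈ P, zdPlaquetteObs (fundamentalRep (Fin 2)) p.1 p.2.1.1 p.2.1.2 U;
        ymSpecification (d := 4) (fundamentalRep (Fin 2)) (βW / 2) Λ η] ≤ χ * P.card :=
  kernel_variance_sum_plaquette_le (d := 4) (N := 2) (by norm_num)
    (fun Λ η => isProbabilityMeasure_ymSpecification _ (continuous_fundamentalRep (Fin 2)) _ Λ η)
    (A := 32) (m := Real.log 2) (by norm_num) (Real.log_pos (by norm_num))
    (fun Λ η F₁ F₂ Λ₁ Λ₂ K₁ K₂ hF₁ hF₂ => su2_wilson_kernel_clustering_upTo_oneTwelfth h0 h Λ η hF₁ hF₂)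

end Summit.Ventures.YMGap.RobustBall

end
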